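import Literature.AlgebraicGeometry.Frobenioids.ArchimedeanDirections
import Literature.AlgebraicGeometry.Frobenioids.ArchimedeanTheoremsInstances
import Literature.AlgebraicGeometry.Frobenioids.ArchimedeanIsotropy
import Literature.AlgebraicGeometry.Frobenioids.ArchimedeanUnitStabilizers
import Literature.AlgebraicGeometry.Frobenioids.ArchimedeanPseudoTerminal
import Literature.AlgebraicGeometry.Frobenioids.ArchimedeanIsometrization
import HarnessLib

/-!
# Frobenioids II, Theorem 3.6 (ii), "`A^istr` is of model type, with rational function monoid `Φ^∡`"
# — PROVED for the angular Frobenioid `A` over any base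

Mochizuki, *The geometry of Frobenioids II*, Kyushu J. Math. **62** (2008) 401–460, §3, Theorem 3.6 (ii),
author's kurims text p. 37 [cite: MochizukiFrdII2008, Thm 3.6 (ii) p.37]: "The Frobenioid `A^istr` is
of base-trivial and model type, with rational function monoid naturally isomorphic to `Φ^∡`" (`Φ^∡`
the restriction to `D` of `Spec(K) ↦ O_K^×`, p. 36).

DISCHARGE of the instance `ArchFrd.Thm36ii_istrModel_A π` of `ArchimedeanTheoremsInstances.lean` (the
typed reading of "model type": `A^istr` is equivalent, compatibly with the structure functors to
`F_0`, to the MODEL FROBENIOID of [FrdI] Thm. 5.2 (abc-iut-L1-t2's `ModelFrobenioid`) of the datum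
`Φ^∡ → 0^gp`): `thm36ii_istrModel_A`. The equivalence `A^istr ⥲ model`: an isotropic object
`(Spec K, V, A_K; B_D)` goes to `(B_D, 0)`, an isometry `(b, d, c; b_D)` between isotropic objects to
`(d, b_D, 0, u)` with `u ∈ O^×` the unit part of `c` read over `π(B_D)` (the class `α ∈ 0^gp` and the
divisor being trivial). Full: an isometry between isotropic objects with prescribed degree, base and unit
part exists and is unique (its absolute value is forced by the tips); essentially surjective: every
`(B_D, α)` is the image of the tip-`1` isotropic object over `B_D` (`0^gp` is trivial). The functor is
compatible ON THE NOSE with the functors to `F_0`. Everything is PROVED; no statement of the paper is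
strengthened; nothing here bears on [IUTchIII].
-/

namespace Literature.AlgebraicGeometry.Frobenioids

open CategoryTheory Opposite
open scoped Pointwise

noncomputable section

universe v u

namespace ArchFrd

/-! ### Scalars: unit parts of `K`-scalars; the groupification of the zero monoid is trivial -/

/-- The unit part of a scalar of `K` is a scalar of `K`. [cite: MochizukiFrdII2008, Def 3.1 (ii) p.24] -/
theorem unitPart_coe_mem_scalars {K : D0} {c : ℂˣ} (hc : c ∈ D0.scalars K) :
    ((unitPart ℂ c : ↥(normOneSubgroup ℂ)) : ℂˣ) ∈ D0.scalars K :=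
  mul_mem hc (inv_mem (ofPosReal_mem_scalars _ K))

/-- The unit part of a scalar of `K` as an element of `O_K^×`. [cite: MochizukiFrdII2008, Def 3.1 (ii) p.24] -/
def D0.unitScalarOf (K : D0) (c : ℂˣ) (hc : c ∈ D0.scalars K) : ↥(D0.unitScalars K) :=
  ⟨(unitPart ℂ c : ℂˣ), unitPart_coe_mem_scalars hc, (mem_normOneSubgroup_iff ℂ _).1 (unitPart ℂ c).2⟩

/-- The unit part is compatible with powers. [cite: MochizukiFrdII2008, Def 3.1 (ii) p.24] -/
theorem unitPart_pow (c : ℂˣ) (n : ℕ) : unitPart ℂ (c ^ n) = unitPart ℂ c ^ n :=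
  congrArg Prod.fst (map_pow (unitDecomposition ℂ).symm c n)

/-- The unit part of a Galois twist, in `ℂ^×`. [cite: MochizukiFrdII2008, Def 3.1 (iv) p.24] -/
theorem coe_unitPart_galAct (σ : Bool) (c : ℂˣ) :
    ((unitPart ℂ (D0.galAct σ c) : ↥(normOneSubgroup ℂ)) : ℂˣ) = D0.galAct σ (unitPart ℂ c : ℂˣ) := by
  rw [unitPart_galAct, coe_unitGal]

/-- `Φ^gp` of the zero monoid is the trivial group. [cite: MochizukiFrdI2008, Prop. 4.4(i) p.83] -/
theorem gp_zeroMonoid_eq_one {D : Type u} [Category.{v} D] (A : Dᵒᵖ)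
    (g : Algebra.GrothendieckGroup ((zeroMonoid D : Dᵒᵖ ⥤ CommMonCat.{0}).obj A)) : g = 1 := by
  induction g using Localization.induction_on with
  | H p =>
    have hp : p.1 = (p.2 : ((zeroMonoid D : Dᵒᵖ ⥤ CommMonCat.{0}).obj A)) := Subsingleton.elim _ _
    rw [hp]; exact Localization.mk_self _

namespace C0

variable {X Y : C0}

/-- CONSTRUCTOR: an arrow `(b, d, c) : X → Y` of `C₀` into a naively isotropic `Y` is given by any
`K`-scalar `c` with `|c| · tip(X)^d ≤ tip(Y)`. [cite: MochizukiFrdII2008, Ex 3.3 (i) p.27] -/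
def homOfNorm (X Y : C0) (b : X.base ⟶ Y.base) (d : ℕ+) (c : ℂˣ) (hc : c ∈ D0.scalars X.base)
    (hY : Y.IsNaivelyIsotropic) (hn : ‖(c : ℂ)‖ * X.tip ^ (d : ℕ) ≤ Y.tip) : X ⟶ Y where
  base := b
  degFr := d
  scalar := c
  scalar_mem := hc
  mapsTo := by
    rintro _ ⟨v, hv, rfl⟩
    have hv' : ‖(v : ℂ)‖ ≤ X.tip ^ (d : ℕ) := norm_le_of_mem_carrier_pow X.region _ _ hv
    change c * v ∈ D0.galAct _ '' Y.region.carrier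
    rw [image_galAct_of_isIsotropic hY, mem_carrier_of_isIsotropic hY, ← Subtype.coe_le_coe, coe_absHom,
      Units.val_mul, norm_mul]
    calc ‖(c : ℂ)‖ * ‖(v : ℂ)‖ ≤ ‖(c : ℂ)‖ * X.tip ^ (d : ℕ) := by gcongr
      _ ≤ Y.tip := hn

end C0

variable {D : Type u} [Category.{v} D] (π : D ⥤ D0)

/-- Shorthand: the full subcategory `A^istr` of isotropic objects of the angular Frobenioid.
[cite: MochizukiFrdII2008, Thm 3.6 (ii) p.37] -/
abbrev AIstr : Type u := (PreFrobenioid.isotropicObjects (A.toElem π)).FullSubcategory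

/-- An object of `A^istr` has naively isotropic angular region (Ex. 3.3 (iii) + (ii), abc-iut-L1-t6).
[cite: MochizukiFrdII2008, Ex 3.3 (iii) p.29] -/
theorem AIstr.isNaivelyIsotropic (X : AIstr π) : X.obj.obj.fst.IsNaivelyIsotropic :=
  (Ex33ii_isotropic_iff_holds π X.obj.obj).1 ((Ex33iii_isotropic_iff_holds π X.obj).1 X.property)

/-! ### The unit `u_φ ∈ Φ^∡(B_D)` of an arrow of `C` -/

/-- The unit part of the scalar of `φ : X → Y` read over `π(X_D)` (transported along `X_base ≅ π(X_D)`):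
the component `u_φ ∈ Φ^∡(X_D) = O^×_{π(X_D)}`. [cite: MochizukiFrdII2008, Thm 3.6 (ii) p.37] -/
def unitOf {X Y : C π} (φ : X ⟶ Y) : ↥(D0.unitScalars (π.obj X.snd)) :=
  D0.unitPull X.iso.inv (D0.unitScalarOf _ (C0.scalar φ.fst) (C0.Hom.scalar_mem φ.fst))

/-- The underlying unit of `unitOf φ`. [cite: MochizukiFrdII2008, Thm 3.6 (ii) p.37] -/
theorem coe_unitOf {X Y : C π} (φ : X ⟶ Y) :
    ((unitOf π φ : ↥(D0.unitScalars (π.obj X.snd))) : ℂˣ) =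
      D0.galAct (D0.Hom.twists X.iso.inv) (unitPart ℂ (C0.scalar φ.fst) : ℂˣ) := rfl

/-- `u_{id} = 1`. [cite: MochizukiFrdII2008, Thm 3.6 (ii) p.37] -/
theorem unitOf_id (X : C π) : unitOf π (𝟙 X) = 1 := by
  apply Subtype.ext
  rw [coe_unitOf]
  change D0.galAct _ (unitPart ℂ (1 : ℂˣ) : ℂˣ) = 1
  rw [unitPart_one, Subgroup.coe_one, map_one]

/-- The twist of the base of the first component of an arrow of `C`, decomposed along the identifications
of the source and target. [cite: MochizukiFrdII2008, Ex 3.3 (i) p.28] -/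
theorem galAct_twists_base_fst {X Y : C π} (ψ : X ⟶ Y) {u : ℂˣ} (hu : u ∈ D0.scalars Y.fst.base) :
    D0.galAct (D0.Hom.twists (C0.Base ψ.fst)) u =
      D0.galAct (D0.Hom.twists X.iso.hom)
        (D0.galAct (D0.Hom.twists (π.map ψ.snd)) (D0.galAct (D0.Hom.twists Y.iso.inv) u)) := by
  have hw := PreFrobenioid.FiberProduct.hom_w ψ
  have hb : PreFrobenioid.Base C0.toElem ψ.fst = X.e.hom ≫ π.map ψ.snd ≫ Y.e.inv := by
    rw [← Category.assoc, ← hw, Category.assoc, Iso.hom_inv_id, Category.comp_id]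
  change D0.galAct (D0.Hom.twists (PreFrobenioid.Base C0.toElem ψ.fst)) u =
    D0.galAct (D0.Hom.twists X.e.hom)
      (D0.galAct (D0.Hom.twists (π.map ψ.snd)) (D0.galAct (D0.Hom.twists Y.e.inv) u))
  have hu' : u ∈ D0.scalars (PreFrobenioid.baseObj C0.toElem Y.fst) := hu
  rw [hb, D0.galAct_twists_comp _ _ hu', D0.galAct_twists_comp _ _ hu']

/-- The twist of `X_base ≅ π(X_D)` and of its inverse agree. [cite: MochizukiFrdII2008, Def 3.1 (i) p.23] -/
theorem twists_iso_inv (X : C π) : D0.Hom.twists X.iso.inv = D0.Hom.twists X.iso.hom := by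
  rw [← IsIso.Iso.inv_hom]; exact D0.twists_inv X.iso.hom

/-- `u_{ψ ≫ φ} = ψ_D^*(u_φ) · u_ψ^{deg φ}` (the composite law of the units of the model Frobenioid).
[cite: MochizukiFrdII2008, Thm 3.6 (ii) p.37] -/
theorem unitOf_comp {X Y Z : C π} (ψ : X ⟶ Y) (φ : Y ⟶ Z) :
    unitOf π (ψ ≫ φ) = D0.unitPull (π.map ψ.snd) (unitOf π φ) * unitOf π ψ ^ (C0.degFr φ.fst : ℕ) := by
  apply Subtype.ext
  rw [Subgroup.coe_mul, Subgroup.coe_pow, D0.coe_unitPull, coe_unitOf, coe_unitOf, coe_unitOf]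
  change D0.galAct _ ((unitPart ℂ ((C0.Base ψ.fst).act (C0.scalar φ.fst) *
      C0.scalar ψ.fst ^ (C0.degFr φ.fst : ℕ))) : ℂˣ) = _
  rw [unitPart_mul, unitPart_pow, Subgroup.coe_mul, Subgroup.coe_pow, map_mul, map_pow]
  congr 1
  change D0.galAct _ ((unitPart ℂ (D0.galAct _ (C0.scalar φ.fst))) : ℂˣ) = _
  rw [coe_unitPart_galAct,
    galAct_twists_base_fst π ψ (unitPart_coe_mem_scalars (C0.Hom.scalar_mem φ.fst)), twists_iso_inv,
    D0.galAct_galAct]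

/-! ### The functor `A^istr → model(Φ^∡ → 0)` -/

/-- The object part: `(Spec K, V, A_K; B_D) ↦ (B_D, 0)`. [cite: MochizukiFrdII2008, Thm 3.6 (ii) p.37] -/
abbrev istrToModelObj (X : AIstr π) : unitModel π := ⟨X.obj.obj.snd, 1⟩

/-- The morphism part: `(b, d, c; b_D) ↦ (d, b_D, 0, u_φ)`. [cite: MochizukiFrdII2008, Thm 3.6 (ii) p.37] -/
def istrToModelMap {X Y : AIstr π} (f : X ⟶ Y) : istrToModelObj π X ⟶ istrToModelObj π Y where
  degFr := C0.degFr f.hom.1.fst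
  base := f.hom.1.snd
  div := 1
  unit := unitOf π f.hom.1
  rel := (gp_zeroMonoid_eq_one _ _).trans (gp_zeroMonoid_eq_one _ _).symm

/-- **The comparison functor `A^istr → model(Φ^∡ → 0^gp)`** of Thm. 3.6 (ii).
[cite: MochizukiFrdII2008, Thm 3.6 (ii) p.37] -/
def istrToModel : AIstr π ⥤ unitModel π where
  obj := istrToModelObj π
  map := istrToModelMap π
  map_id X := by
    refine ModelFrobenioid.hom_ext rfl rfl rfl ?_
    exact unitOf_id π X.obj.obj
  map_comp f g := by
    refine ModelFrobenioid.hom_ext (mul_comm _ _) rfl (Subsingleton.elim _ _) ?_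
    exact unitOf_comp π f.hom.1 g.hom.1

/-! ### Faithful -/

/-- Two isometries of `C` between isotropic objects with the same degree, `D`-component and unit agree.
[cite: MochizukiFrdII2008, Thm 3.6 (ii) p.37] -/
theorem eq_of_unitOf_eq {X Y : C π} {φ ψ : X ⟶ Y} (hφ : PreFrobenioid.IsIsometry (C.toElem π) φ)
    (hψ : PreFrobenioid.IsIsometry (C.toElem π) ψ) (hd : C0.degFr φ.fst = C0.degFr ψ.fst)
    (hs : φ.snd = ψ.snd) (hu : unitOf π φ = unitOf π ψ) : φ = ψ := by
  have hφ' : PreFrobenioid.IsIsometry C0.toElem φ.fst := hφ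
  have hψ' : PreFrobenioid.IsIsometry C0.toElem ψ.fst := hψ
  rw [A0.isIsometry_iff_norm_mul_tip_pow] at hφ' hψ'
  have hbase : PreFrobenioid.Base C0.toElem φ.fst = PreFrobenioid.Base C0.toElem ψ.fst := by
    refine (cancel_mono Y.e.hom).1 ?_
    rw [PreFrobenioid.FiberProduct.hom_w, PreFrobenioid.FiberProduct.hom_w, hs]
  refine CFP.hom_ext (C0.hom_ext hbase hd ?_) hs
  apply eq_of_unitPart_eq_of_absHom_eq
  · have h := congrArg (fun w : ↥(D0.unitScalars (π.obj X.snd)) =>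
      D0.galAct (D0.Hom.twists X.iso.inv) (w : ℂˣ)) hu
    simp only [coe_unitOf, D0.galAct_galAct] at h
    exact Subtype.ext h
  · apply Subtype.ext
    rw [coe_absHom, coe_absHom]
    rw [hd] at hφ'
    have hT : (0 : ℝ) < X.fst.tip ^ (C0.degFr ψ.fst : ℕ) := pow_pos X.fst.tip_pos _
    exact mul_right_cancel₀ hT.ne' (hφ'.trans hψ'.symm)

/-- The comparison functor is faithful. [cite: MochizukiFrdII2008, Thm 3.6 (ii) p.37] -/
theorem faithful_istrToModel : (istrToModel π).Faithful where
  map_injective {X Y} f g h := by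
    apply ObjectProperty.hom_ext
    apply WideSubcategory.hom_ext _
    exact eq_of_unitOf_eq π f.hom.2 g.hom.2 (congrArg ModelFrobenioid.degFr h)
      (congrArg ModelFrobenioid.baseMap h) (congrArg ModelFrobenioid.unit h)

/-! ### Full -/

section Full

variable {X Y : AIstr π} (m : istrToModelObj π X ⟶ istrToModelObj π Y)

/-- The unit `u ∈ O^×_{π(X_D)}` of `m`. [cite: MochizukiFrdII2008, Thm 3.6 (ii) p.37] -/
def mUnit : ↥(D0.unitScalars (π.obj X.obj.obj.snd)) := ModelFrobenioid.unit m

/-- The absolute value forced on an isometry `X → Y` of degree `d`: `tip(Y)/tip(X)^d`.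
[cite: MochizukiFrdII2008, Thm 3.6 (ii) p.37] -/
def preRatio : PosReal :=
  ⟨Y.obj.obj.fst.tip / X.obj.obj.fst.tip ^ (ModelFrobenioid.degFr m : ℕ),
    div_pos Y.obj.obj.fst.tip_pos (pow_pos X.obj.obj.fst.tip_pos _)⟩

/-- The scalar of the preimage: `(tip(Y)/tip(X)^d) · ι(u)`. [cite: MochizukiFrdII2008, Thm 3.6 (ii) p.37] -/
def preScalar : ℂˣ :=
  ofPosReal ℂ (preRatio π m) * D0.galAct (D0.Hom.twists X.obj.obj.iso.hom) (mUnit π m : ℂˣ)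

/-- The scalar of the preimage is a scalar of the base field of `X`. [cite: MochizukiFrdII2008, Ex 3.3 (i) p.27] -/
theorem preScalar_mem : preScalar π m ∈ D0.scalars X.obj.obj.fst.base :=
  mul_mem (ofPosReal_mem_scalars _ _) (C0.act_mem_scalars X.obj.obj.iso.hom (mUnit π m).2.1)

/-- The norm of the preimage scalar. [cite: MochizukiFrdII2008, Thm 3.6 (ii) p.37] -/
theorem norm_preScalar :
    ‖(preScalar π m : ℂ)‖ = Y.obj.obj.fst.tip / X.obj.obj.fst.tip ^ (ModelFrobenioid.degFr m : ℕ) := by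
  rw [preScalar, Units.val_mul, norm_mul, C0.norm_coe_ofPosReal, D0.norm_galAct, (mUnit π m).2.2, mul_one]
  rfl

/-- The `C₀`-component of the preimage. [cite: MochizukiFrdII2008, Thm 3.6 (ii) p.37] -/
def preFst : X.obj.obj.fst ⟶ Y.obj.obj.fst :=
  C0.homOfNorm _ _ (X.obj.obj.e.hom ≫ π.map (ModelFrobenioid.baseMap m) ≫ Y.obj.obj.e.inv)
    (ModelFrobenioid.degFr m) (preScalar π m) (preScalar_mem π m) (AIstr.isNaivelyIsotropic π Y)
    (by
      rw [norm_preScalar]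
      exact le_of_eq (div_mul_cancel₀ _ (pow_pos X.obj.obj.fst.tip_pos _).ne'))

/-- The preimage in `C`. [cite: MochizukiFrdII2008, Thm 3.6 (ii) p.37] -/
def preHom : X.obj.obj ⟶ Y.obj.obj where
  fst := preFst π m
  snd := ModelFrobenioid.baseMap m
  w := by
    change (X.obj.obj.e.hom ≫ π.map (ModelFrobenioid.baseMap m) ≫ Y.obj.obj.e.inv) ≫ Y.obj.obj.e.hom =
      X.obj.obj.e.hom ≫ π.map (ModelFrobenioid.baseMap m)
    rw [Category.assoc, Category.assoc, Iso.inv_hom_id, Category.comp_id]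

/-- The preimage is an isometry. [cite: MochizukiFrdII2008, Thm 3.6 (ii) p.37] -/
theorem isIsometry_preHom : PreFrobenioid.IsIsometry (C.toElem π) (preHom π m) := by
  have h : PreFrobenioid.IsIsometry C0.toElem (preFst π m) := by
    rw [A0.isIsometry_iff_norm_mul_tip_pow]
    change ‖(preScalar π m : ℂ)‖ * X.obj.obj.fst.tip ^ (ModelFrobenioid.degFr m : ℕ) = Y.obj.obj.fst.tip
    rw [norm_preScalar]
    exact div_mul_cancel₀ _ (pow_pos X.obj.obj.fst.tip_pos _).ne'
  exact h

/-- The preimage in `A^istr`. [cite: MochizukiFrdII2008, Thm 3.6 (ii) p.37] -/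
def preOver : X ⟶ Y := ObjectProperty.homMk ⟨preHom π m, isIsometry_preHom π m⟩

/-- The unit of the preimage is the prescribed one. [cite: MochizukiFrdII2008, Thm 3.6 (ii) p.37] -/
theorem unitOf_preHom : unitOf π (preHom π m) = mUnit π m := by
  apply Subtype.ext
  rw [coe_unitOf]
  change D0.galAct _ ((unitPart ℂ (preScalar π m)) : ℂˣ) = _
  rw [preScalar, unitPart_ofPosReal_mul, coe_unitPart_galAct,
    UnitStab.unitPart_eq_of_norm_eq_one _ (mUnit π m).2.2, twists_iso_inv, D0.galAct_galAct]

/-- The functor maps the preimage to `m`. [cite: MochizukiFrdII2008, Thm 3.6 (ii) p.37] -/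
theorem map_preOver : (istrToModel π).map (preOver π m) = m :=
  ModelFrobenioid.hom_ext rfl rfl (Subsingleton.elim _ _) (unitOf_preHom π m)

end Full

/-- The comparison functor is full. [cite: MochizukiFrdII2008, Thm 3.6 (ii) p.37] -/
theorem full_istrToModel : (istrToModel π).Full :=
  ⟨fun m => ⟨preOver π m, map_preOver π m⟩⟩

/-! ### Essentially surjective -/

/-- The tip-`1` isotropic object over `B ∈ Ob(D)` as an object of `A^istr`.
[cite: MochizukiFrdII2008, Thm 3.6 (ii) p.37] -/
def unitAIstr (B : D) : AIstr π :=
  ⟨⟨unitObjOver π B⟩, (Ex33iii_isotropic_iff_holds π _).2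
    ((Ex33ii_isotropic_iff_holds π _).2 (AngularRegion.isIsotropic_isotropicOfTip 1))⟩

/-- The comparison functor is essentially surjective (`0^gp` is trivial). [cite: MochizukiFrdII2008, Thm 3.6 (ii) p.37] -/
theorem essSurj_istrToModel : (istrToModel π).EssSurj where
  mem_essImage W := by
    refine ⟨unitAIstr π W.base, ⟨eqToIso ?_⟩⟩
    obtain ⟨B, α⟩ := W
    change (⟨B, 1⟩ : unitModel π) = ⟨B, α⟩
    rw [gp_zeroMonoid_eq_one _ α]

/-- The comparison functor is an equivalence. [cite: MochizukiFrdII2008, Thm 3.6 (ii) p.37] -/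
theorem isEquivalence_istrToModel : (istrToModel π).IsEquivalence where
  faithful := faithful_istrToModel π
  full := full_istrToModel π
  essSurj := essSurj_istrToModel π

/-- Compatibility with the structure functors to `F_0`, ON THE NOSE. [cite: MochizukiFrdII2008, Thm 3.6 (ii) p.37] -/
theorem istrToModel_comp_toElem :
    istrToModel π ⋙ ModelFrobenioid.toElem (zeroMonoid D : Dᵒᵖ ⥤ CommMonCat.{0}) (unitMonoid π)
        (unitMonoidDivZero π) = istr (A.toElem π) := rfl

/-- **Theorem 3.6 (ii), "`A^istr` is of model type, with rational function monoid `Φ^∡`"** (PROVED over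
any base `π : D → D₀`): `A^istr` is equivalent to the model Frobenioid of `Φ^∡ → 0^gp`, compatibly with
the structure functors. [cite: MochizukiFrdII2008, Thm 3.6 (ii) p.37] -/
theorem thm36ii_istrModel_A : Thm36ii_istrModel_A π := by
  haveI := isEquivalence_istrToModel π
  exact ⟨(istrToModel π).asEquivalence, ⟨eqToIso (istrToModel_comp_toElem π)⟩⟩

end ArchFrd

end

end Literature.AlgebraicGeometry.Frobenioids
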